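import Literature.AnabelianGeometry.SemiGraphs.TemperedCor39cDischargeAt
import Literature.AnabelianGeometry.SemiGraphs.ArithBranchGeometricPartAt
import Literature.AnabelianGeometry.SemiGraphs.ArithEdgeLikeTwoHosts
import Literature.AnabelianGeometry.SemiGraphs.ArithLevelData
import HarnessLib

/-!
# [SemiAnbd] Thm 5.4 (iii) ↔ Cor 3.9 junction: TRANSPORT of the kernel-level antecedents of the binder
# `hCor39c` to the chart-level shadows, and the chart-level discharge (proof-only)

Mochizuki, *Semi-graphs of anabelioids*, Publ. RIMS **42** (2006), §5, Theorem 5.4 (iii), manuscript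
p. 66 ("the proofs are entirely parallel to those of Theorem 3.7, Corollary 3.9"); §5 p. 65
("`Π^temp_{𝔾,v} := Π^temp_{𝔊,v} ∩ Π^temp_𝔾`"); §3 Cor. 3.9 pp. 42–43 [cite: MochizukiSemiAnbd2006, Thm 5.4 (iii), p. 66].

PROOF-ONLY (cell abc-iut, layer L3; L3-lead ruling α22-4 (i) «hCor39c TRANSPORT», seat abc-iut-w4-d083;
no definition).  The compat-augmented junction binder `hCor39c` of the Thm 5.4 (iii) umbrella
(abc-iut-w5-d141, `ArithQuasiGeometricSurjectiveCompat.lean`, geometric-indexed form of record) speaks about a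
continuous `f : Π^temp_𝔊 → Π^temp_ℍ` over `A` through the DATA of p. 65 — the produced decomposition data
`decompositionDataOfChart R ι` of abc-iut-w4-d053 (`Π^temp_{𝔊,v}` = the commensurator of `ι(Π^temp_{𝔾,v})`)
— while the geometric Cor. 3.9 (b) lives on the tempered CHARTS (`TemperedPiChart`).  This file transports
the three antecedents of `hCor39c` across that dictionary:
* `MapsOntoOpenSubgroupOf.conj` / `.of_map`, `exists_continuousLift_of_range` — bookkeeping ("maps onto an
  open subgroup of" is conjugation-equivariant and descends along the embeddings `ι_𝔾`, `ι_ℍ`; `f` over `A`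
  restricts to a continuous `f' : π₁^temp(𝔾) → π₁^temp(ℍ)`);
* `shadowV_of_kernelShadowV` / `shadowE_of_kernelShadowE` / `shadowC_of_kernelShadowC` — antecedent 1 / 2 / 3
  of `hCor39c` for `f` ⇒ the chart-level shadows `hV` / `hE` / `hC` of `isCompatiblyQuasiGeometric_of_shadows′`
  (abc-iut-w4-d083) for `f'`, via abc-iut-w4-d040's LEVEL-A dictionary `arithVertGp_inf_range_eq_map` /
  `arithBrGp_inf_range_eq_mapAt` (`Π^temp_{𝔊,v} ∩ Ker = ι(Π^temp_{𝔾,v})`, Thm 3.7 (iii) at the graph for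
  branches) and the `ArithChartAction` of `ℍ` (conjugates by `x ∈ Π^temp_ℍ` of geometric verticial /
  edge-like subgroups are geometric verticial / edge-like subgroups at the translated vertex / edge);
* `exists_hom_chartPullbackWith_iso_of_kernelShadows` — the composition with abc-iut-w4-d080's per-pair
  discharge `exists_hom_chartPullbackWith_iso_of_shadowsAt′`: a locally open `F : 𝔾 → ℍ` inducing `f'` up
  to twist, modulo Thm 3.7 (iii) AT `𝔾` AND AT `ℍ`.
NOT here (producer packaging, abc-iut-w4-d053 / merge-bridge lane): reading `F : ProfiniteSemiGraph.Hom 𝔾 ℍ`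
as a morphism `𝔊.G ⟶ ℍ.G` and the umbrella's datum `ι g` as the `F`-induced map (the literal last line
`f x = h * ι g x * h⁻¹` of `hCor39c`), and the input `hadj`.  Nothing asserted for real tempered data;
nothing here bears on [IUTchIII] Cor. 3.12; typed ≠ proved.
-/

namespace Literature.AnabelianGeometry.SemiGraphs

open _root_.CategoryTheory _root_.Topology

universe u uG uH uP

/-! ### Group-theoretic bookkeeping -/

section Bookkeeping

variable {Gtp : Type uG} [Group Gtp] {Htp : Type uH} [Group Htp] [TopologicalSpace Htp]

omit [TopologicalSpace Htp] in
/-- Membership in a conjugate subgroup. [folklore] -/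
private theorem conj_mem_conjSubgroup_iff (c t : Htp) (T : Subgroup Htp) :
    (MulAut.conj c) t ∈ conjSubgroup c T ↔ t ∈ T := by
  constructor
  · rintro ⟨s, hs, hst⟩
    rwa [← (MulAut.conj c).injective hst]
  · exact fun ht => ⟨t, ht, rfl⟩

/-- **"Maps onto an open subgroup of" is conjugation-equivariant**: if `f` maps `S` onto an open
subgroup of `T`, it maps `a·S·a⁻¹` onto an open subgroup of `f(a)·T·f(a)⁻¹` (a step of the arithmetic
translation of Cor. 3.9, Thm 5.4 (iii) p. 66). [cite: MochizukiSemiAnbd2006, Thm 5.4 (iii), p. 66] -/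
theorem MapsOntoOpenSubgroupOf.conj [IsTopologicalGroup Htp] {f : Gtp →* Htp} {S : Subgroup Gtp}
    {T : Subgroup Htp} (h : MapsOntoOpenSubgroupOf f S T) (a : Gtp) :
    MapsOntoOpenSubgroupOf f (conjSubgroup a S) (conjSubgroup (f a) T) := by
  have hmap : (conjSubgroup a S).map f = conjSubgroup (f a) (S.map f) := map_conjSubgroup_eq f a S
  refine ⟨?_, ?_⟩
  · rw [hmap]
    exact Subgroup.map_mono h.1
  · obtain ⟨V, hV, hVeq⟩ := isOpen_induced_iff.mp h.2
    let ψ : Htp ≃ₜ Htp := (Homeomorph.mulLeft (f a)).trans (Homeomorph.mulRight (f a)⁻¹)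
    have hψ : ∀ x, ψ x = (MulAut.conj (f a)) x := fun x => by
      simp [ψ, MulAut.conj_apply]
    refine isOpen_induced_iff.mpr ⟨ψ '' V, ψ.isOpenMap V hV, ?_⟩
    rw [hmap]
    ext ⟨y, hy⟩
    obtain ⟨t, ht, rfl⟩ := hy
    have hVt : t ∈ V ↔ t ∈ (S.map f : Set Htp) := by
      have := congrArg (fun s : Set T => (⟨t, ht⟩ : T) ∈ s) hVeq
      simpa using this
    simp only [Set.mem_preimage, SetLike.mem_coe, MulEquiv.coe_toMonoidHom]
    rw [conj_mem_conjSubgroup_iff, ← hψ, ψ.injective.mem_set_image]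
    exact hVt

variable {P : Type*} [Group P] {Q : Type*} [Group Q] [TopologicalSpace Q]

/-- **"Maps onto an open subgroup of" descends along embeddings**: for `ι_P : P → G`, `ι_Q : Q ↪ H`
(injective, continuous) and `f' : P → Q` with `ι_Q ∘ f' = f ∘ ι_P`, if `f` maps `ι_P(K)` onto an open
subgroup of `ι_Q(K₂)` then `f'` maps `K` onto an open subgroup of `K₂` (restriction of Thm 5.4 (iii)'s
condition to the geometric tempered groups, p. 66). [cite: MochizukiSemiAnbd2006, Thm 5.4 (iii), p. 66] -/
theorem MapsOntoOpenSubgroupOf.of_map (ιP : P →* Gtp) (ιQ : Q →* Htp) (hιQ : Function.Injective ιQ)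
    (hιQc : Continuous ιQ) {f : Gtp →* Htp} {f' : P →* Q} (hf' : ∀ x, ιQ (f' x) = f (ιP x))
    {K : Subgroup P} {K₂ : Subgroup Q} (h : MapsOntoOpenSubgroupOf f (K.map ιP) (K₂.map ιQ)) :
    MapsOntoOpenSubgroupOf f' K K₂ := by
  have hmm : (K.map ιP).map f = (K.map f').map ιQ := by
    rw [Subgroup.map_map, Subgroup.map_map]
    congr 1
    ext x
    exact (hf' x).symm
  refine ⟨?_, ?_⟩
  · intro q hq
    obtain ⟨k, hk, rfl⟩ := hq
    have h0 : ιQ (f' k) ∈ (K.map ιP).map f := by rw [hmm]; exact ⟨f' k, ⟨k, hk, rfl⟩, rfl⟩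
    have h1 : ιQ (f' k) ∈ K₂.map ιQ := h.1 h0
    obtain ⟨q, hq₂, hq⟩ := h1
    rwa [← hιQ hq]
  · let j : K₂ → ↥(K₂.map ιQ) := fun q => ⟨ιQ q, q, q.2, rfl⟩
    have hj : Continuous j := (hιQc.comp continuous_subtype_val).subtype_mk _
    have hset : (Subtype.val : K₂ → Q) ⁻¹' (K.map f' : Set Q) =
        j ⁻¹' ((Subtype.val : ↥(K₂.map ιQ) → Htp) ⁻¹' ((K.map ιP).map f : Set Htp)) := by
      ext ⟨q, hq⟩
      simp only [Set.mem_preimage, SetLike.mem_coe, j, hmm]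
      constructor
      · exact fun hq' => ⟨q, hq', rfl⟩
      · rintro ⟨q', hq', hqq⟩
        rwa [← hιQ hqq]
    rw [hset]
    exact h.2.preimage hj

variable [TopologicalSpace Gtp] [TopologicalSpace P]

/-- **A homomorphism over `A` restricts to the geometric tempered groups**: if `f(ι_P(P)) ⊆ ι_Q(Q)` with
`ι_Q` an injective EMBEDDING and `f ∘ ι_P` continuous, there is a continuous `f' : P → Q` with
`ι_Q ∘ f' = f ∘ ι_P` (Prop. 5.2 (iv) exact sequences; Thm 5.4 (iii) «over `A^⊤`», p. 66).
[cite: MochizukiSemiAnbd2006, Thm 5.4 (iii), p. 66] -/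
theorem exists_continuousLift_of_range (ιP : P →* Gtp) (hιPc : Continuous ιP) (ιQ : Q →* Htp)
    (hιQ : Function.Injective ιQ) (hemb : IsEmbedding ιQ) (f : Gtp →* Htp) (hf : Continuous f)
    (hrange : ∀ p, f (ιP p) ∈ ιQ.range) :
    ∃ f' : P →ₜ* Q, ∀ x, ιQ (f' x) = f (ιP x) := by
  choose g hg using hrange
  have hmul : ∀ x y, g (x * y) = g x * g y := by
    intro x y
    apply hιQ
    rw [map_mul, hg, hg, hg, map_mul, map_mul]
  have hcont : Continuous g := by
    rw [hemb.continuous_iff]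
    have : (ιQ : Q → Htp) ∘ g = fun x => f (ιP x) := funext hg
    rw [this]
    exact hf.comp hιPc
  exact ⟨⟨MonoidHom.mk' g hmul, hcont⟩, hg⟩

end Bookkeeping

namespace ProfiniteSemiGraph

variable {𝒢 ℋ : ProfiniteSemiGraph.{u}} {c𝒢 : TemperedPiChart 𝒢} {cℋ : TemperedPiChart ℋ}
variable {Gtp : Type uG} [Group Gtp]
variable {Htp : Type uH} [Group Htp] [TopologicalSpace Htp]
variable {PA : Type uP} [Group PA] [TopologicalSpace PA]

omit [TopologicalSpace PA] in
/-- `Π^temp_{𝔊,v} ∩ Ker aug = ι(Π^temp_{𝔾,v})` for the produced data (abc-iut-w4-d040's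
`arithVertGp_inf_range_eq_map`, in kernel currency). [cite: MochizukiSemiAnbd2006, §5, p. 65] -/
theorem vertGp_inf_ker_eq_map (h𝒢 : 𝒢.Thm37Hypotheses) (R : ChartRepresentatives c𝒢) (ι : c𝒢.G →* Gtp)
    (hι : Function.Injective ι) (aug : Gtp →* PA) (hexact : ι.range = aug.ker) (v : 𝒢.graph.Vertex) :
    (decompositionDataOfChart R ι).vertGp v ⊓ aug.ker = (R.Hv v).map ι := by
  rw [← hexact]
  exact arithVertGp_inf_range_eq_map h𝒢 R ι hι v

omit [TopologicalSpace PA] in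
/-- `Π^temp_{𝔊,b} ∩ Ker aug = ι(Π^temp_{𝔾,b})` for the produced data, modulo Thm 3.7 (iii) at the graph
(abc-iut-w4-d040's `arithBrGp_inf_range_eq_mapAt`, in kernel currency). [cite: MochizukiSemiAnbd2006, §5, p. 65] -/
theorem brGp_inf_ker_eq_map (h𝒢iii : CompactInVerticialAt 𝒢) (h𝒢 : 𝒢.Thm37Hypotheses)
    (hG : 𝒢.graph.IsGraph) (R : ChartRepresentatives c𝒢) (ι : c𝒢.G →* Gtp) (hι : Function.Injective ι)
    (aug : Gtp →* PA) (hexact : ι.range = aug.ker) (b : 𝒢.graph.Branch) :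
    (decompositionDataOfChart R ι).brGp b ⊓ aug.ker = (R.Hb b).map ι := by
  rw [← hexact]
  exact arithBrGp_inf_range_eq_mapAt h𝒢iii h𝒢 hG R ι hι b

omit [TopologicalSpace Htp] in
/-- The geometric part of an ARBITRARY conjugate `x·Π^temp_{ℍ,w}·x⁻¹` (`x ∈ Π^temp_ℍ`) is `ι` of a verticial
subgroup at the translated vertex `(aug x)·w` (`ArithChartAction.conj_verticial`).
[cite: MochizukiSemiAnbd2006, §5, p. 65] -/
theorem conj_vertGp_inf_ker_eq_map (hℋ : ℋ.Thm37Hypotheses) (R' : ChartRepresentatives cℋ)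
    (ι : cℋ.G →* Htp) (hι : Function.Injective ι) (aug : Htp →* PA) (hexact : ι.range = aug.ker)
    {actV : PA → ℋ.graph.Vertex → ℋ.graph.Vertex} {actE : PA → ℋ.graph.Edge → ℋ.graph.Edge}
    {actB : PA → ℋ.graph.Branch → ℋ.graph.Branch} (A : ArithChartAction cℋ ι aug actV actE actB)
    (x : Htp) (w : ℋ.graph.Vertex) :
    ∃ H' ∈ verticialSubgroups cℋ (actV (aug x) w),
      conjSubgroup x ((decompositionDataOfChart R' ι).vertGp w) ⊓ aug.ker = H'.map ι := by
  haveI : aug.ker.Normal := MonoidHom.normal_ker aug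
  obtain ⟨H', hH', hconj⟩ := A.conj_verticial x w (R'.Hv w) (R'.Hv_mem w)
  refine ⟨H', hH', ?_⟩
  rw [← conjSubgroup_inf_of_normal, vertGp_inf_ker_eq_map hℋ R' ι hι aug hexact w, hconj]

omit [TopologicalSpace Htp] in
/-- The geometric part of an arbitrary conjugate `x·Π^temp_{ℍ,b}·x⁻¹` is `ι` of an edge-like subgroup of the
translated (closed) edge. [cite: MochizukiSemiAnbd2006, §5, p. 65] -/
theorem conj_brGp_inf_ker_eq_map (hℋiii : CompactInVerticialAt ℋ) (hℋ : ℋ.Thm37Hypotheses)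
    (hH : ℋ.graph.IsGraph) (R' : ChartRepresentatives cℋ) (ι : cℋ.G →* Htp) (hι : Function.Injective ι)
    (aug : Htp →* PA) (hexact : ι.range = aug.ker)
    {actV : PA → ℋ.graph.Vertex → ℋ.graph.Vertex} {actE : PA → ℋ.graph.Edge → ℋ.graph.Edge}
    {actB : PA → ℋ.graph.Branch → ℋ.graph.Branch} (A : ArithChartAction cℋ ι aug actV actE actB)
    (x : Htp) (b : ℋ.graph.Branch) :
    ∃ K' ∈ edgeLikeSubgroups cℋ (actE (aug x) (ℋ.graph.edgeOf b)),
      conjSubgroup x ((decompositionDataOfChart R' ι).brGp b) ⊓ aug.ker = K'.map ι := by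
  haveI : aug.ker.Normal := MonoidHom.normal_ker aug
  obtain ⟨K', hK', hconj⟩ := A.conj_edgeLike x (ℋ.graph.edgeOf b) (R'.Hb b) (R'.Hb_mem b)
  refine ⟨K', hK', ?_⟩
  rw [← conjSubgroup_inf_of_normal, brGp_inf_ker_eq_map hℋiii hℋ hH R' ι hι aug hexact b, hconj]

/-- **Antecedent 1 ⇒ `hV`.**  If `f` maps the geometric part of every `Π^temp_{𝔊,v}` onto an open subgroup
of the geometric part of a conjugate of some `Π^temp_{ℍ,w}`, then the restriction `f'` of `f` to the geometric
tempered groups maps EVERY verticial subgroup of `π₁^temp(𝔾)` onto an open subgroup of a verticial subgroup of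
`π₁^temp(ℍ)`. [cite: MochizukiSemiAnbd2006, Thm 5.4 (iii), p. 66] -/
theorem shadowV_of_kernelShadowV [IsTopologicalGroup Htp] (h𝒢 : 𝒢.Thm37Hypotheses)
    (hℋ : ℋ.Thm37Hypotheses) (R : ChartRepresentatives c𝒢) (R' : ChartRepresentatives cℋ)
    (ι𝒢 : c𝒢.G →* Gtp) (ιℋ : cℋ.G →* Htp) (hι𝒢 : Function.Injective ι𝒢) (hιℋ : Function.Injective ιℋ)
    (hιℋc : Continuous ιℋ) (augG : Gtp →* PA) (augH' : Htp →* PA) (hex𝒢 : ι𝒢.range = augG.ker)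
    (hexℋ : ιℋ.range = augH'.ker)
    {actV : PA → ℋ.graph.Vertex → ℋ.graph.Vertex} {actE : PA → ℋ.graph.Edge → ℋ.graph.Edge}
    {actB : PA → ℋ.graph.Branch → ℋ.graph.Branch} (A : ArithChartAction cℋ ιℋ augH' actV actE actB)
    {f : Gtp →* Htp} {f' : c𝒢.G →* cℋ.G} (hf' : ∀ x, ιℋ (f' x) = f (ι𝒢 x))
    (h1 : ∀ v : 𝒢.graph.Vertex, ∃ (w : ℋ.graph.Vertex) (x : Htp),
      MapsOntoOpenSubgroupOf f ((decompositionDataOfChart R ι𝒢).vertGp v ⊓ augG.ker)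
        (conjSubgroup x ((decompositionDataOfChart R' ιℋ).vertGp w) ⊓ augH'.ker)) :
    ∀ (v : 𝒢.graph.Vertex) (K : Subgroup c𝒢.G), K ∈ verticialSubgroups c𝒢 v →
      ∃ (w : ℋ.graph.Vertex) (K₂ : Subgroup cℋ.G), K₂ ∈ verticialSubgroups cℋ w ∧
        MapsOntoOpenSubgroupOf f' K K₂ := by
  haveI : augH'.ker.Normal := MonoidHom.normal_ker augH'
  intro v K hK
  obtain ⟨k, rfl⟩ := exists_conj_of_mem_verticialSubgroups c𝒢 (R.Hv_mem v) hK
  obtain ⟨w, x, hm⟩ := h1 v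
  rw [vertGp_inf_ker_eq_map h𝒢 R ι𝒢 hι𝒢 augG hex𝒢 v] at hm
  have hm' := hm.conj (ι𝒢 k)
  rw [← map_conjSubgroup_eq, conjSubgroup_inf_of_normal, ← conjSubgroup_mul] at hm'
  obtain ⟨H', hH', hH'eq⟩ :=
    conj_vertGp_inf_ker_eq_map hℋ R' ιℋ hιℋ augH' hexℋ A (f (ι𝒢 k) * x) w
  rw [hH'eq] at hm'
  exact ⟨_, H', hH', MapsOntoOpenSubgroupOf.of_map ι𝒢 ιℋ hιℋ hιℋc hf' hm'⟩

/-- **Antecedent 2 ⇒ `hE`** (primed shape: no nontriviality of the target recorded).  If `f` maps the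
geometric part of every `Π^temp_{𝔊,b}` onto an open subgroup of the geometric part of a conjugate of some
`Π^temp_{ℍ,b'}`, then `f'` maps every edge-like subgroup of a closed edge of `π₁^temp(𝔾)` onto an open subgroup
of an edge-like subgroup of a closed edge of `π₁^temp(ℍ)` — modulo Thm 3.7 (iii) at `𝔾` and at `ℍ` (the branch
dictionary). [cite: MochizukiSemiAnbd2006, Thm 5.4 (iii), p. 66] -/
theorem shadowE_of_kernelShadowE [IsTopologicalGroup Htp] (h𝒢iii : CompactInVerticialAt 𝒢)
    (hℋiii : CompactInVerticialAt ℋ) (h𝒢 : Cor39Hypotheses 𝒢) (hℋ : Cor39Hypotheses ℋ)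
    (R : ChartRepresentatives c𝒢) (R' : ChartRepresentatives cℋ)
    (ι𝒢 : c𝒢.G →* Gtp) (ιℋ : cℋ.G →* Htp) (hι𝒢 : Function.Injective ι𝒢) (hιℋ : Function.Injective ιℋ)
    (hιℋc : Continuous ιℋ) (augG : Gtp →* PA) (augH' : Htp →* PA) (hex𝒢 : ι𝒢.range = augG.ker)
    (hexℋ : ιℋ.range = augH'.ker)
    {actV : PA → ℋ.graph.Vertex → ℋ.graph.Vertex} {actE : PA → ℋ.graph.Edge → ℋ.graph.Edge}
    {actB : PA → ℋ.graph.Branch → ℋ.graph.Branch} (A : ArithChartAction cℋ ιℋ augH' actV actE actB)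
    {f : Gtp →* Htp} {f' : c𝒢.G →* cℋ.G} (hf' : ∀ x, ιℋ (f' x) = f (ι𝒢 x))
    (h2 : ∀ b : 𝒢.graph.Branch, ∃ (b' : ℋ.graph.Branch) (x : Htp),
      MapsOntoOpenSubgroupOf f ((decompositionDataOfChart R ι𝒢).brGp b ⊓ augG.ker)
        (conjSubgroup x ((decompositionDataOfChart R' ιℋ).brGp b') ⊓ augH'.ker)) :
    ∀ (e : 𝒢.graph.Edge) (L : Subgroup c𝒢.G), 𝒢.graph.IsClosedEdge e →
      L ∈ edgeLikeSubgroups c𝒢 e → L ≠ ⊥ →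
      ∃ (e' : ℋ.graph.Edge) (L₂ : Subgroup cℋ.G), ℋ.graph.IsClosedEdge e' ∧
        L₂ ∈ edgeLikeSubgroups cℋ e' ∧ MapsOntoOpenSubgroupOf f' L L₂ := by
  haveI : augH'.ker.Normal := MonoidHom.normal_ker augH'
  intro e L _ hL _
  obtain ⟨b, -, -, hbe, -, -⟩ := 𝒢.graph.two_branches e
  have hb : R.Hb b ∈ edgeLikeSubgroups c𝒢 e := hbe ▸ R.Hb_mem b
  obtain ⟨k, rfl⟩ := exists_conj_of_mem_edgeLikeSubgroups c𝒢 hb hL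
  obtain ⟨b', x, hm⟩ := h2 b
  rw [brGp_inf_ker_eq_map h𝒢iii h𝒢.thm37Hypotheses h𝒢.isGraph R ι𝒢 hι𝒢 augG hex𝒢 b] at hm
  have hm' := hm.conj (ι𝒢 k)
  rw [← map_conjSubgroup_eq, conjSubgroup_inf_of_normal, ← conjSubgroup_mul] at hm'
  obtain ⟨K', hK', hK'eq⟩ :=
    conj_brGp_inf_ker_eq_map hℋiii hℋ.thm37Hypotheses hℋ.isGraph R' ιℋ hιℋ augH' hexℋ A
      (f (ι𝒢 k) * x) b'
  rw [hK'eq] at hm'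
  exact ⟨_, K', isClosedEdge_of_isGraph hℋ.isGraph _, hK',
    MapsOntoOpenSubgroupOf.of_map ι𝒢 ιℋ hιℋ hιℋc hf' hm'⟩

omit [TopologicalSpace Htp] in
/-- **Antecedent 3 ⇒ `hC`** (the compatibility clause; geometric-indexed antecedent of record).  If `f`
carries the geometric parts of two conjugates `γ₁·Π^temp_{𝔊,v₁}·γ₁⁻¹`, `γ₂·Π^temp_{𝔊,v₂}·γ₂⁻¹` that are
distinct and meet non-trivially INTO two conjugates of `Π^temp_{ℍ,w₁}`, `Π^temp_{ℍ,w₂}` with distinct geometric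
parts, respectively, then `f'` carries two distinct verticial subgroups of `π₁^temp(𝔾)` meeting non-trivially
into two distinct verticial subgroups of `π₁^temp(ℍ)`, respectively.
[cite: MochizukiSemiAnbd2006, Thm 5.4 (iii), p. 66] -/
theorem shadowC_of_kernelShadowC (h𝒢 : 𝒢.Thm37Hypotheses) (hℋ : ℋ.Thm37Hypotheses)
    (R : ChartRepresentatives c𝒢) (R' : ChartRepresentatives cℋ)
    (ι𝒢 : c𝒢.G →* Gtp) (ιℋ : cℋ.G →* Htp) (hι𝒢 : Function.Injective ι𝒢) (hιℋ : Function.Injective ιℋ)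
    (augG : Gtp →* PA) (augH' : Htp →* PA) (hex𝒢 : ι𝒢.range = augG.ker) (hexℋ : ιℋ.range = augH'.ker)
    {actV : PA → ℋ.graph.Vertex → ℋ.graph.Vertex} {actE : PA → ℋ.graph.Edge → ℋ.graph.Edge}
    {actB : PA → ℋ.graph.Branch → ℋ.graph.Branch} (A : ArithChartAction cℋ ιℋ augH' actV actE actB)
    {f : Gtp →* Htp} (hover : augH'.comp f = augG) {f' : c𝒢.G →* cℋ.G}
    (hf' : ∀ x, ιℋ (f' x) = f (ι𝒢 x))
    (h3 : ∀ (v₁ v₂ : 𝒢.graph.Vertex) (γ₁ γ₂ : Gtp),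
      conjSubgroup γ₁ ((decompositionDataOfChart R ι𝒢).vertGp v₁) ⊓ augG.ker ≠
          conjSubgroup γ₂ ((decompositionDataOfChart R ι𝒢).vertGp v₂) ⊓ augG.ker →
      conjSubgroup γ₁ ((decompositionDataOfChart R ι𝒢).vertGp v₁) ⊓
          conjSubgroup γ₂ ((decompositionDataOfChart R ι𝒢).vertGp v₂) ⊓ augG.ker ≠ ⊥ →
        ∃ (w₁ w₂ : ℋ.graph.Vertex) (x₁ x₂ : Htp),
          conjSubgroup x₁ ((decompositionDataOfChart R' ιℋ).vertGp w₁) ⊓ augH'.ker ≠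
              conjSubgroup x₂ ((decompositionDataOfChart R' ιℋ).vertGp w₂) ⊓ augH'.ker ∧
          (conjSubgroup γ₁ ((decompositionDataOfChart R ι𝒢).vertGp v₁) ⊓ augG.ker).map f ≤
              conjSubgroup x₁ ((decompositionDataOfChart R' ιℋ).vertGp w₁) ∧
          (conjSubgroup γ₂ ((decompositionDataOfChart R ι𝒢).vertGp v₂) ⊓ augG.ker).map f ≤
              conjSubgroup x₂ ((decompositionDataOfChart R' ιℋ).vertGp w₂)) :
    ∀ (v₁ v₂ : 𝒢.graph.Vertex) (K₁ H₁ : Subgroup c𝒢.G), K₁ ∈ verticialSubgroups c𝒢 v₁ →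
      H₁ ∈ verticialSubgroups c𝒢 v₂ → K₁ ≠ H₁ → K₁ ⊓ H₁ ≠ ⊥ →
      ∃ (w₁ w₂ : ℋ.graph.Vertex) (K₂ H₂ : Subgroup cℋ.G), K₂ ∈ verticialSubgroups cℋ w₁ ∧
        H₂ ∈ verticialSubgroups cℋ w₂ ∧ K₂ ≠ H₂ ∧ K₁.map f' ≤ K₂ ∧ H₁.map f' ≤ H₂ := by
  haveI : augG.ker.Normal := MonoidHom.normal_ker augG
  haveI : augH'.ker.Normal := MonoidHom.normal_ker augH'
  intro v₁ v₂ K₁ H₁ hK₁ hH₁ hne hnt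
  obtain ⟨k₁, rfl⟩ := exists_conj_of_mem_verticialSubgroups c𝒢 (R.Hv_mem v₁) hK₁
  obtain ⟨k₂, rfl⟩ := exists_conj_of_mem_verticialSubgroups c𝒢 (R.Hv_mem v₂) hH₁
  have hgeo : ∀ (v : 𝒢.graph.Vertex) (k : c𝒢.G),
      conjSubgroup (ι𝒢 k) ((decompositionDataOfChart R ι𝒢).vertGp v) ⊓ augG.ker =
        ((R.Hv v).map (MulAut.conj k).toMonoidHom).map ι𝒢 := by
    intro v k
    rw [← conjSubgroup_inf_of_normal, vertGp_inf_ker_eq_map h𝒢 R ι𝒢 hι𝒢 augG hex𝒢 v,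
      map_conjSubgroup_eq]
  have hne' : conjSubgroup (ι𝒢 k₁) ((decompositionDataOfChart R ι𝒢).vertGp v₁) ⊓ augG.ker ≠
      conjSubgroup (ι𝒢 k₂) ((decompositionDataOfChart R ι𝒢).vertGp v₂) ⊓ augG.ker := by
    rw [hgeo, hgeo]
    exact fun h => hne (Subgroup.map_injective hι𝒢 h)
  have hnt' : conjSubgroup (ι𝒢 k₁) ((decompositionDataOfChart R ι𝒢).vertGp v₁) ⊓
      conjSubgroup (ι𝒢 k₂) ((decompositionDataOfChart R ι𝒢).vertGp v₂) ⊓ augG.ker ≠ ⊥ := by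
    rw [show ∀ A B C : Subgroup Gtp, A ⊓ B ⊓ C = (A ⊓ C) ⊓ (B ⊓ C) from fun A B C => by
        rw [inf_inf_inf_comm, inf_idem], hgeo, hgeo, ← Subgroup.map_inf _ _ ι𝒢 hι𝒢]
    exact fun h => hnt ((Subgroup.map_eq_bot_iff_of_injective _ hι𝒢).mp h)
  obtain ⟨w₁, w₂, x₁, x₂, hTne, hle₁, hle₂⟩ := h3 v₁ v₂ (ι𝒢 k₁) (ι𝒢 k₂) hne' hnt'
  obtain ⟨K₂, hK₂, hK₂eq⟩ := conj_vertGp_inf_ker_eq_map hℋ R' ιℋ hιℋ augH' hexℋ A x₁ w₁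
  obtain ⟨H₂, hH₂, hH₂eq⟩ := conj_vertGp_inf_ker_eq_map hℋ R' ιℋ hιℋ augH' hexℋ A x₂ w₂
  have hker : ∀ y : c𝒢.G, f (ι𝒢 y) ∈ augH'.ker := by
    intro y
    rw [MonoidHom.mem_ker, ← MonoidHom.comp_apply, hover, ← MonoidHom.mem_ker, ← hex𝒢]
    exact ⟨y, rfl⟩
  have hinto : ∀ (v : 𝒢.graph.Vertex) (k : c𝒢.G) (x : Htp) (w : ℋ.graph.Vertex) (T : Subgroup cℋ.G),
      (conjSubgroup (ι𝒢 k) ((decompositionDataOfChart R ι𝒢).vertGp v) ⊓ augG.ker).map f ≤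
        conjSubgroup x ((decompositionDataOfChart R' ιℋ).vertGp w) →
      conjSubgroup x ((decompositionDataOfChart R' ιℋ).vertGp w) ⊓ augH'.ker = T.map ιℋ →
      ((R.Hv v).map (MulAut.conj k).toMonoidHom).map f' ≤ T := by
    intro v k x w T hle hT q hq
    obtain ⟨y, hy, rfl⟩ := hq
    have h1 : f (ι𝒢 y) ∈ conjSubgroup x ((decompositionDataOfChart R' ιℋ).vertGp w) ⊓ augH'.ker :=
      Subgroup.mem_inf.mpr ⟨hle ⟨ι𝒢 y, (hgeo v k).symm ▸ ⟨y, hy, rfl⟩, rfl⟩, hker y⟩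
    rw [hT, ← hf'] at h1
    obtain ⟨t, ht, htq⟩ := h1
    rwa [← hιℋ htq]
  refine ⟨_, _, K₂, H₂, hK₂, hH₂, fun hEq => hTne ?_, hinto v₁ k₁ x₁ w₁ K₂ hle₁ hK₂eq,
    hinto v₂ k₂ x₂ w₂ H₂ hle₂ hH₂eq⟩
  rw [hK₂eq, hH₂eq, hEq]

/-- **`hCor39c`, transported and discharged at the charts** (modulo Thm 3.7 (iii) AT `𝔾` AND AT `ℍ`): for
`f : Π^temp_𝔊 → Π^temp_ℍ` continuous over `A` satisfying the three kernel-level antecedents of the junction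
binder `hCor39c` (per-vertex shadow, per-branch shadow, compatibility shadow — the latter in the
geometric-indexed form of record), the restriction `f'` of `f` to the geometric tempered groups (through the
embeddings `ι_𝔾`, `ι_ℍ` of the producer) is induced, up to twist, by a LOCALLY OPEN morphism of semi-graphs of
anabelioids `F : 𝔾 → ℍ`: the geometric Cor. 3.9 (b) of abc-iut-w4-d080
(`exists_hom_chartPullbackWith_iso_of_shadowsAt′`) applied to the transported shadows.  The remaining step to
the literal conclusion of `hCor39c` — reading `F` and the twisted chart pullback as `f x = h · ι g x · h⁻¹` for
the umbrella's datum `ι` — is the producer's packaging. [cite: MochizukiSemiAnbd2006, Thm 5.4 (iii), p. 66] -/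
theorem exists_hom_chartPullbackWith_iso_of_kernelShadows [TopologicalSpace Gtp] [IsTopologicalGroup Htp]
    (h𝒢iii : CompactInVerticialAt 𝒢) (hℋiii : CompactInVerticialAt ℋ) (h𝒢 : Cor39Hypotheses 𝒢)
    (hℋ : Cor39Hypotheses ℋ) (R : ChartRepresentatives c𝒢) (R' : ChartRepresentatives cℋ)
    (ι𝒢 : c𝒢.G →* Gtp) (ιℋ : cℋ.G →* Htp) (hι𝒢 : Function.Injective ι𝒢) (hι𝒢c : Continuous ι𝒢)
    (hιℋ : Function.Injective ιℋ) (hιℋe : IsEmbedding ιℋ)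
    (augG : Gtp →* PA) (augH' : Htp →* PA) (hex𝒢 : ι𝒢.range = augG.ker) (hexℋ : ιℋ.range = augH'.ker)
    {actV : PA → ℋ.graph.Vertex → ℋ.graph.Vertex} {actE : PA → ℋ.graph.Edge → ℋ.graph.Edge}
    {actB : PA → ℋ.graph.Branch → ℋ.graph.Branch} (A : ArithChartAction cℋ ιℋ augH' actV actE actB)
    (f : Gtp →* Htp) (hf : Continuous f) (hover : augH'.comp f = augG)
    (h1 : ∀ v : 𝒢.graph.Vertex, ∃ (w : ℋ.graph.Vertex) (x : Htp),
      MapsOntoOpenSubgroupOf f ((decompositionDataOfChart R ι𝒢).vertGp v ⊓ augG.ker)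
        (conjSubgroup x ((decompositionDataOfChart R' ιℋ).vertGp w) ⊓ augH'.ker))
    (h2 : ∀ b : 𝒢.graph.Branch, ∃ (b' : ℋ.graph.Branch) (x : Htp),
      MapsOntoOpenSubgroupOf f ((decompositionDataOfChart R ι𝒢).brGp b ⊓ augG.ker)
        (conjSubgroup x ((decompositionDataOfChart R' ιℋ).brGp b') ⊓ augH'.ker))
    (h3 : ∀ (v₁ v₂ : 𝒢.graph.Vertex) (γ₁ γ₂ : Gtp),
      conjSubgroup γ₁ ((decompositionDataOfChart R ι𝒢).vertGp v₁) ⊓ augG.ker ≠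
          conjSubgroup γ₂ ((decompositionDataOfChart R ι𝒢).vertGp v₂) ⊓ augG.ker →
      conjSubgroup γ₁ ((decompositionDataOfChart R ι𝒢).vertGp v₁) ⊓
          conjSubgroup γ₂ ((decompositionDataOfChart R ι𝒢).vertGp v₂) ⊓ augG.ker ≠ ⊥ →
        ∃ (w₁ w₂ : ℋ.graph.Vertex) (x₁ x₂ : Htp),
          conjSubgroup x₁ ((decompositionDataOfChart R' ιℋ).vertGp w₁) ⊓ augH'.ker ≠
              conjSubgroup x₂ ((decompositionDataOfChart R' ιℋ).vertGp w₂) ⊓ augH'.ker ∧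
          (conjSubgroup γ₁ ((decompositionDataOfChart R ι𝒢).vertGp v₁) ⊓ augG.ker).map f ≤
              conjSubgroup x₁ ((decompositionDataOfChart R' ιℋ).vertGp w₁) ∧
          (conjSubgroup γ₂ ((decompositionDataOfChart R ι𝒢).vertGp v₂) ⊓ augG.ker).map f ≤
              conjSubgroup x₂ ((decompositionDataOfChart R' ιℋ).vertGp w₂)) :
    ∃ f' : c𝒢.G →ₜ* cℋ.G, (∀ x, ιℋ (f' x) = f (ι𝒢 x)) ∧
      ∃ F : Hom 𝒢 ℋ, F.IsLocallyOpen ∧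
        ∃ θ : F.ConjugatorFamily, Nonempty (F.chartPullbackWith θ c𝒢 cℋ ≅ BTemp.res f') := by
  have hrange : ∀ p, f (ι𝒢 p) ∈ ιℋ.range := by
    intro p
    rw [hexℋ, MonoidHom.mem_ker, ← MonoidHom.comp_apply, hover, ← MonoidHom.mem_ker, ← hex𝒢]
    exact ⟨p, rfl⟩
  obtain ⟨f', hf'⟩ := exists_continuousLift_of_range ι𝒢 hι𝒢c ιℋ hιℋ hιℋe f hf hrange
  refine ⟨f', hf', exists_hom_chartPullbackWith_iso_of_shadowsAt' h𝒢iii hℋiii h𝒢 hℋ c𝒢 cℋ f' ?_ ?_ ?_⟩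
  · exact shadowV_of_kernelShadowV h𝒢.thm37Hypotheses hℋ.thm37Hypotheses R R' ι𝒢 ιℋ hι𝒢 hιℋ
      hιℋe.continuous augG augH' hex𝒢 hexℋ A hf' h1
  · exact shadowE_of_kernelShadowE h𝒢iii hℋiii h𝒢 hℋ R R' ι𝒢 ιℋ hι𝒢 hιℋ hιℋe.continuous augG augH'
      hex𝒢 hexℋ A hf' h2
  · exact shadowC_of_kernelShadowC h𝒢.thm37Hypotheses hℋ.thm37Hypotheses R R' ι𝒢 ιℋ hι𝒢 hιℋ augG
      augH' hex𝒢 hexℋ A hover hf' h3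

end ProfiniteSemiGraph

end Literature.AnabelianGeometry.SemiGraphs
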